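import Literature.Analysis.Complex.ThreeChamberLevelArc
import HarnessLib

/-!
# The three-chamber configuration, III: germs of the chambers and two-sidedness in the disc

Topic: Analysis / Complex. Third file of the tree's rendering of the proof of Lemma 5.4 of
G. F. Lawler, O. Schramm, W. Werner, Ann. Probab. **32** (2004) ("For `j = 1, 2, 3`, let `K_j` be
the connected component of `D ∖ (A₁ ∪ A₂ ∪ A₃)` which does not have `A_j` as a subset of its
boundary"). For a `Setup` `S` we provide the tools shared by the two cases of the chamber lemma:

* `biLoop`: a Jordan loop through two arcs with common endpoints (from `triLoop`);
* `Setup.image_ψ_eq`, `Setup.isOpen_image_ψ` (`ψ` is open onto its image in `𝔻`),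
  `Setup.not_subset_closedBall_of_mem_closure` (**points approaching `∂Ω` have `ψ`-images
  approaching `∂𝔻`**, by compactness and `F ∘ ψ = id`), `Setup.isJordanLoop_comp_ψ`;
* `Setup.rho`: a radius `ρ₀ ≤ r/2` below which the two `∂Q'`-gates near `x` are the initial
  pieces `σ [0, ¼)`, `σ (-⅛, 0]` (so gate `1` has `side ≥ 0` and gate `2` has `side ≤ 0` in
  `B(x, ρ₀)`);
* the **germs** `Setup.regP m ρ` of the chamber `K_m` at `x` (`P_0 = B(x,ρ) ∖ Q̄'`,
  `P_1 = B(x,ρ) ∩ Q' ∩ {side < 0}`, `P_2 = B(x,ρ) ∩ Q' ∩ {side > 0}`) and the complementary germs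
  `Setup.regP' m ρ` (joined through gate `m`), with their covering, connectedness and incidence
  properties, and explicit witnesses (`V_inter_ball_nonempty`, `gate_inter_regP'_nonempty`);
* the **approach paths** `Setup.apr m` (`t ↦ (1-t) x`, `t ↦ σ(τ₊ t)`, `t ↦ σ(τ₋ t)`) mapping
  `[0, 1)` injectively onto gate `m` and ending at a point of `∂Ω`;
* **two-sidedness at `c = ψ x` in the disc** (`Setup.two_sided`): for a Jordan loop `j ∋ c`
  which near `c` consists of `ψ`-images of the two gates other than `m`, the images `ψ(P_m)`,
  `ψ(P'_m)` lie on different sides of `j`; and the propagation from the germ to whole chambers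
  (`Setup.image_subset_inside_of_germ`, `Setup.image_subset_inside_of_germ'`).

Everything here is proved.

## References

* G. F. Lawler, O. Schramm, W. Werner, Ann. Probab. 32 (2004), proof of Lemma 5.4.
  [LawlerSchrammWerner2004]
-/

noncomputable section

open Set Filter Metric Function Complex Real
open _root_.Topology
open Literature.Topology.PlaneTopology

namespace Literature.Analysis.Complex

namespace ThreeChamber

/-! ### Loops through two arcs -/

section BiLoop

variable {g₁ g₂ : ℝ → ℂ}

/-- **The loop through two arcs with common endpoints**: `g₁`, then `g₂` backwards (realised as a
`triLoop` whose connector is the second half of `g₂`, reversed). [folklore] -/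
def biLoop (g₁ g₂ : ℝ → ℂ) : ℝ → ℂ :=
  triLoop g₁ (fun u ↦ g₂ (1 - u / 2)) (fun u ↦ g₂ (u / 2))

/-- **Two arcs meeting exactly at their common endpoints form a Jordan loop**, with range the
union of the two traces. [folklore] -/
theorem isJordanLoop_biLoop (hg₁c : ContinuousOn g₁ (Icc 0 1)) (hg₂c : ContinuousOn g₂ (Icc 0 1))
    (hg₁i : InjOn g₁ (Icc 0 1)) (hg₂i : InjOn g₂ (Icc 0 1)) (h0 : g₁ 0 = g₂ 0) (h1 : g₁ 1 = g₂ 1)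
    (h12 : g₁ '' Icc 0 1 ∩ g₂ '' Icc 0 1 ⊆ {g₁ 0, g₁ 1}) :
    IsJordanLoop (biLoop g₁ g₂) ∧ range (biLoop g₁ g₂) = g₁ '' Icc 0 1 ∪ g₂ '' Icc 0 1 := by
  have hm1 : ∀ u ∈ Icc (0 : ℝ) 1, 1 - u / 2 ∈ Icc (0 : ℝ) 1 := fun u hu ↦
    ⟨by linarith [hu.2], by linarith [hu.1]⟩
  have hm2 : ∀ u ∈ Icc (0 : ℝ) 1, u / 2 ∈ Icc (0 : ℝ) 1 := fun u hu ↦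
    ⟨by linarith [hu.1], by linarith [hu.2]⟩
  have hβc : ContinuousOn (fun u ↦ g₂ (1 - u / 2)) (Icc 0 1) := hg₂c.comp (by fun_prop) hm1
  have hγc : ContinuousOn (fun u ↦ g₂ (u / 2)) (Icc 0 1) := hg₂c.comp (by fun_prop) hm2
  have hβi : InjOn (fun u ↦ g₂ (1 - u / 2)) (Icc 0 1) := fun u hu v hv huv ↦ by
    have := hg₂i (hm1 u hu) (hm1 v hv) huv; linarith
  have hγi : InjOn (fun u ↦ g₂ (u / 2)) (Icc 0 1) := fun u hu v hv huv ↦ by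
    have := hg₂i (hm2 u hu) (hm2 v hv) huv; linarith
  -- images of the two halves
  have himβ : (fun u ↦ g₂ (1 - u / 2)) '' Icc 0 1 = g₂ '' Icc (1 / 2) 1 := by
    ext z; constructor
    · rintro ⟨u, hu, rfl⟩; exact ⟨1 - u / 2, ⟨by linarith [hu.2], by linarith [hu.1]⟩, rfl⟩
    · rintro ⟨v, hv, rfl⟩
      exact ⟨2 - 2 * v, ⟨by linarith [hv.2], by linarith [hv.1]⟩, by
        show g₂ (1 - (2 - 2 * v) / 2) = g₂ v; congr 1; ring⟩
  have himγ : (fun u ↦ g₂ (u / 2)) '' Icc 0 1 = g₂ '' Icc 0 (1 / 2) := by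
    ext z; constructor
    · rintro ⟨u, hu, rfl⟩; exact ⟨u / 2, ⟨by linarith [hu.1], by linarith [hu.2]⟩, rfl⟩
    · rintro ⟨v, hv, rfl⟩
      exact ⟨2 * v, ⟨by linarith [hv.1], by linarith [hv.2]⟩, by
        show g₂ (2 * v / 2) = g₂ v; congr 1; ring⟩
  have hsub1 : g₂ '' Icc (1 / 2) 1 ⊆ g₂ '' Icc 0 1 := image_mono (Icc_subset_Icc_left (by norm_num))
  have hsub2 : g₂ '' Icc 0 (1 / 2) ⊆ g₂ '' Icc 0 1 := image_mono (Icc_subset_Icc_right (by norm_num))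
  have hA : g₁ '' Icc 0 1 ∩ (fun u ↦ g₂ (u / 2)) '' Icc 0 1 ⊆ {g₁ 0} := by
    -- `g₁ ∩ g₂[0, ½] ⊆ {g₁ 0}`
    rw [himγ]
    rintro z ⟨hz1, ⟨v, hv, rfl⟩⟩
    rcases h12 ⟨hz1, hsub2 ⟨v, hv, rfl⟩⟩ with h | h
    · exact h
    · exfalso
      rw [mem_singleton_iff, h1] at h
      have := hg₂i ⟨hv.1, by linarith [hv.2]⟩ (right_mem_Icc.2 zero_le_one) h
      linarith [hv.2]
  have hB : g₁ '' Icc 0 1 ∩ (fun u ↦ g₂ (1 - u / 2)) '' Icc 0 1 ⊆ {g₁ 1} := by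
    -- `g₁ ∩ g₂[½, 1] ⊆ {g₁ 1}`
    rw [himβ]
    rintro z ⟨hz1, ⟨v, hv, rfl⟩⟩
    rcases h12 ⟨hz1, hsub1 ⟨v, hv, rfl⟩⟩ with h | h
    · exfalso
      rw [h0] at h
      have := hg₂i ⟨by linarith [hv.1], hv.2⟩ (left_mem_Icc.2 zero_le_one) h
      linarith [hv.1]
    · exact h
  have hC : (fun u ↦ g₂ (u / 2)) '' Icc 0 1 ∩ (fun u ↦ g₂ (1 - u / 2)) '' Icc 0 1 ⊆
      {(fun u ↦ g₂ (u / 2)) 1} := by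
    -- the two halves meet only at `g₂ (½)`
    rw [himβ, himγ]
    rintro z ⟨⟨u, hu, rfl⟩, ⟨v, hv, huv⟩⟩
    have := hg₂i ⟨by linarith [hv.1], hv.2⟩ ⟨hu.1, by linarith [hu.2]⟩ huv
    rw [mem_singleton_iff]
    show g₂ u = g₂ (1 / 2)
    congr 1; linarith [hu.2, hv.1]
  obtain ⟨hJ, hrange⟩ := isJordanLoop_triLoop hg₁c hγc hβc hg₁i hγi hβi
    (h0.trans (by norm_num)) (by show g₂ (1 - 0 / 2) = g₁ 1; norm_num [h1])
    (by show g₂ (1 - 1 / 2) = g₂ (1 / 2); norm_num) hA hB hC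
  refine ⟨hJ, ?_⟩
  rw [biLoop, hrange, himβ, himγ, union_assoc, ← image_union, union_comm (Icc (1 / 2 : ℝ) 1),
    Icc_union_Icc_eq_Icc (show (0 : ℝ) ≤ 1 / 2 by norm_num) (show (1 / 2 : ℝ) ≤ 1 by norm_num)]

end BiLoop

/-- The range of a Jordan loop has empty interior. [folklore] -/
theorem _root_.Literature.Topology.PlaneTopology.IsJordanLoop.interior_range_eq {γ : ℝ → ℂ}
    (h : IsJordanLoop γ) : interior (range γ) = ∅ := by
  rw [← h.frontier_outside, ← frontier_compl]
  exact interior_frontier h.isOpen_outside.isClosed_compl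

namespace Setup

variable (S : Setup)

/-! ### `ψ` on open sets, compactness -/

/-- `‖x‖ > 0`. [folklore] -/
theorem norm_x_pos : 0 < ‖S.x‖ := lt_of_lt_of_le S.r_pos S.norm_x_ge

/-- `ψ '' O = 𝔻 ∩ F⁻¹(O)` for `O ⊆ Ω`. [folklore] -/
theorem image_ψ_eq {O : Set ℂ} (hO : O ⊆ S.Ω) : S.ψ '' O = ball 0 1 ∩ S.F ⁻¹' O := by
  ext w; constructor
  · rintro ⟨z, hz, rfl⟩
    exact ⟨S.ψ_maps (hO hz), by rw [mem_preimage, S.F_ψ z (hO hz)]; exact hz⟩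
  · rintro ⟨hw, hwO⟩; exact ⟨S.F w, hwO, S.ψ_F w hw⟩

/-- **`ψ` is open**: images of open subsets of `Ω` are open. [folklore] -/
theorem isOpen_image_ψ {O : Set ℂ} (hO : IsOpen O) (hOΩ : O ⊆ S.Ω) : IsOpen (S.ψ '' O) := by
  rw [S.image_ψ_eq hOΩ]
  exact (S.F_cont.mono ball_subset_closedBall).isOpen_inter_preimage isOpen_ball hO

/-- Small balls about `x` lie in `Ω`. [folklore] -/
theorem ball_subset_Ω {ρ : ℝ} (hρ : ρ ≤ 9 * S.r / 10) : ball S.x ρ ⊆ S.Ω :=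
  (ball_subset_ball hρ).trans S.B₀_subset

/-- `ψ(B(x, ρ))` is a neighbourhood of `c`. [folklore] -/
theorem image_ψ_ball_mem_nhds {ρ : ℝ} (hρ0 : 0 < ρ) (hρ : ρ ≤ 9 * S.r / 10) :
    S.ψ '' ball S.x ρ ∈ 𝓝 S.c :=
  (S.isOpen_image_ψ isOpen_ball (S.ball_subset_Ω hρ)).mem_nhds ⟨S.x, mem_ball_self hρ0, rfl⟩

/-- **Points of `Ω` approaching `∂Ω` have `ψ`-images approaching `∂𝔻`**: if `A ⊆ Ω` has a
closure point `q ∉ Ω`, then `ψ(A)` is not contained in any disc `closedBall 0 R`, `R < 1`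
(otherwise a subsequence of `ψ zₙ`, `zₙ → q`, converges in `𝔻` and `zₙ = F (ψ zₙ)` converges
in `Ω`). [folklore] -/
theorem not_subset_closedBall_of_mem_closure {A : Set ℂ} (hA : A ⊆ S.Ω) {q : ℂ}
    (hq : q ∈ closure A) (hqΩ : q ∉ S.Ω) {R : ℝ} (hR : R < 1) : ¬ S.ψ '' A ⊆ closedBall 0 R := by
  intro hsub
  obtain ⟨z, hzA, hzq⟩ := mem_closure_iff_seq_limit.1 hq
  have hw : ∀ n, S.ψ (z n) ∈ closedBall (0 : ℂ) R := fun n ↦ hsub ⟨z n, hzA n, rfl⟩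
  obtain ⟨w, hwR, φ, hφ, hlim⟩ := (isCompact_closedBall (0 : ℂ) R).tendsto_subseq hw
  have hwb : w ∈ ball (0 : ℂ) 1 := by
    rw [mem_ball_zero_iff]; exact (mem_closedBall_zero_iff.1 hwR).trans_lt hR
  have hFc : ContinuousAt S.F w :=
    (S.F_cont.mono ball_subset_closedBall).continuousAt (isOpen_ball.mem_nhds hwb)
  have h1 : Tendsto (fun n ↦ S.F (S.ψ (z (φ n)))) atTop (𝓝 (S.F w)) := hFc.tendsto.comp hlim
  have h2 : Tendsto (fun n ↦ S.F (S.ψ (z (φ n)))) atTop (𝓝 q) := by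
    have : (fun n ↦ S.F (S.ψ (z (φ n)))) = fun n ↦ z (φ n) :=
      funext fun n ↦ S.F_ψ _ (hA (hzA _))
    rw [this]; exact hzq.comp hφ.tendsto_atTop
  exact hqΩ (tendsto_nhds_unique h1 h2 ▸ S.F_maps hwb)

/-- A compact subset of `Ω` has `ψ`-image in a disc `closedBall 0 R`, `R < 1`. [folklore] -/
theorem exists_image_ψ_subset_closedBall {K : Set ℂ} (hK : IsCompact K) (hKΩ : K ⊆ S.Ω) :
    ∃ R < 1, S.ψ '' K ⊆ closedBall 0 R := by
  rcases K.eq_empty_or_nonempty with rfl | hne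
  · exact ⟨0, zero_lt_one, by simp⟩
  obtain ⟨z₀, hz₀, hmax⟩ := hK.exists_isMaxOn hne ((S.ψ_cont.mono hKΩ).norm)
  refine ⟨‖S.ψ z₀‖, mem_ball_zero_iff.1 (S.ψ_maps (hKΩ hz₀)), ?_⟩
  rintro w ⟨z, hz, rfl⟩
  exact mem_closedBall_zero_iff.2 (hmax hz)

/-- The `ψ`-image of a Jordan loop in `Ω` is a Jordan loop. [folklore] -/
theorem isJordanLoop_comp_ψ {γ : ℝ → ℂ} (hγ : IsJordanLoop γ) (hγΩ : range γ ⊆ S.Ω) :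
    IsJordanLoop (S.ψ ∘ γ) := by
  refine ⟨S.ψ_cont.comp_continuous hγ.continuous fun t ↦ hγΩ ⟨t, rfl⟩, fun t ↦ ?_, ?_⟩
  · simp only [Function.comp_apply, hγ.periodic t]
  · intro s hs t ht hst
    exact hγ.injOn hs ht (S.ψ_injOn (hγΩ ⟨s, rfl⟩) (hγΩ ⟨t, rfl⟩) hst)

/-! ### The radius `ρ₀` -/

/-- The far parts of the two `∂Q'`-gates: `σ [¼ ∧ τ₊, τ₊] ∪ σ [τ₋, τ₋ ∨ (-⅛)]`. [folklore] -/
def farGate : Set ℂ :=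
  S.sqLoop '' Icc (min (1 / 4) S.tauP) S.tauP ∪ S.sqLoop '' Icc S.tauM (max S.tauM (-(1 / 8)))

/-- The far gate set is compact. [folklore] -/
theorem isCompact_farGate : IsCompact S.farGate :=
  (isCompact_Icc.image S.continuous_sqLoop).union (isCompact_Icc.image S.continuous_sqLoop)

/-- The far gate set is nonempty. [folklore] -/
theorem farGate_nonempty : S.farGate.Nonempty :=
  ⟨S.sqLoop S.tauP, Or.inl ⟨S.tauP, ⟨min_le_right _ _, le_rfl⟩, rfl⟩⟩

/-- `x` is not in the far gate set. [folklore] -/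
theorem x_notMem_farGate : S.x ∉ S.farGate := by
  obtain ⟨hP, hPn, -⟩ := S.tauP_spec
  obtain ⟨hM, hMn, -⟩ := S.tauM_spec
  have hinj := S.isJordanLoop_sqLoop.injOn
  rintro (⟨t, ht, htx⟩ | ⟨t, ht, htx⟩)
  · have ht0 : 0 < t := lt_of_lt_of_le (lt_min (by norm_num) hP.1) ht.1
    rcases lt_or_eq_of_le (ht.2.trans hP.2) with ht1 | ht1
    · have := hinj ⟨ht0.le, ht1⟩ ⟨le_rfl, zero_lt_one⟩ (htx.trans S.sqLoop_zero.symm)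
      linarith
    · have h1 : S.tauP = 1 := le_antisymm hP.2 (ht1 ▸ ht.2)
      apply hPn
      rw [h1, ← ht1, htx]
      exact S.x_mem
  · have ht0 : t < 0 := lt_of_le_of_lt ht.2 (max_lt hM.2 (by norm_num))
    rcases lt_or_eq_of_le (hM.1.trans ht.1) with ht1 | ht1
    · have hper : S.sqLoop (t + 1) = S.sqLoop t := S.periodic_sqLoop t
      have := hinj ⟨by linarith, by linarith⟩ ⟨le_rfl, zero_lt_one⟩
        ((hper.trans htx).trans S.sqLoop_zero.symm)
      linarith
    · have h1 : S.tauM = t := le_antisymm ht.1 (by rw [← ht1]; exact hM.1)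
      apply hMn
      rw [h1, htx]
      exact S.x_mem

/-- **The radius of two-sidedness `ρ₀`**: `ρ₀ ≤ r/2`, and below it the gates near `x` are the
initial pieces `σ [0, ¼)`, `σ (-⅛, 0]` of `∂Q'`. [folklore] -/
def rho : ℝ := min (S.r / 2) (infDist S.x S.farGate)

/-- `ρ₀ > 0`. [folklore] -/
theorem rho_pos : 0 < S.rho :=
  lt_min (by linarith [S.r_pos]) ((S.isCompact_farGate.isClosed.notMem_iff_infDist_pos
    S.farGate_nonempty).1 S.x_notMem_farGate)

/-- `ρ₀ ≤ r / 2`. [folklore] -/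
theorem rho_le : S.rho ≤ S.r / 2 := min_le_left _ _

/-- `ρ₀ ≤ r`. [folklore] -/
theorem rho_le_r : S.rho ≤ S.r := by linarith [S.rho_le, S.r_pos]

/-- `ρ₀ ≤ 9r/10`. [folklore] -/
theorem rho_le_B₀ : S.rho ≤ 9 * S.r / 10 := by linarith [S.rho_le, S.r_pos]

/-- Points of `B(x, ρ₀)` are off the far gate set. [folklore] -/
theorem notMem_farGate_of_mem_ball {z : ℂ} (hz : z ∈ ball S.x S.rho) : z ∉ S.farGate := fun h ↦ by
  have h1 : infDist S.x S.farGate ≤ dist S.x z := infDist_le_dist_of_mem h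
  have h2 : dist z S.x < S.rho := hz
  have h3 : S.rho ≤ infDist S.x S.farGate := min_le_right _ _
  rw [dist_comm] at h2
  linarith

/-- Gate-`1` points within `ρ₀` of `x` are `σ t` with `t < ¼`. [folklore] -/
theorem lt_quarter_of_mem_ball {t : ℝ} (ht : t ∈ Ico 0 S.tauP) (hz : S.sqLoop t ∈ ball S.x S.rho) :
    t < 1 / 4 := by
  by_contra h
  push Not at h
  exact S.notMem_farGate_of_mem_ball hz (Or.inl ⟨t, ⟨min_le_of_left_le h, ht.2.le⟩, rfl⟩)

/-- Gate-`2` points within `ρ₀` of `x` are `σ t` with `-⅛ < t`. [folklore] -/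
theorem neg_eighth_lt_of_mem_ball {t : ℝ} (ht : t ∈ Ioc S.tauM 0)
    (hz : S.sqLoop t ∈ ball S.x S.rho) : -(1 / 8 : ℝ) < t := by
  by_contra h
  push Not at h
  exact S.notMem_farGate_of_mem_ball hz (Or.inr ⟨t, ⟨ht.1.le, le_max_of_le_right h⟩, rfl⟩)

/-- Gate `1` has `side ≥ 0` within `ρ₀` of `x`. [folklore] -/
theorem side_nonneg_of_mem_gate_one {z : ℂ} (hz : z ∈ S.gate 1) (hzb : z ∈ ball S.x S.rho) :
    0 ≤ S.side z := by
  obtain ⟨t, ht, rfl⟩ : z ∈ S.sqLoop '' Ico 0 S.tauP := hz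
  rcases eq_or_lt_of_le ht.1 with h0 | h0
  · rw [← h0, S.sqLoop_zero, S.side_x]
  · exact (S.side_sqLoop_pos h0 (S.lt_quarter_of_mem_ball ht hzb).le).le

/-- Gate `2` has `side ≤ 0` within `ρ₀` of `x`. [folklore] -/
theorem side_nonpos_of_mem_gate_two {z : ℂ} (hz : z ∈ S.gate 2) (hzb : z ∈ ball S.x S.rho) :
    S.side z ≤ 0 := by
  obtain ⟨t, ht, rfl⟩ : z ∈ S.sqLoop '' Ioc S.tauM 0 := hz
  rcases eq_or_lt_of_le ht.2 with h0 | h0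
  · rw [h0, S.sqLoop_zero, S.side_x]
  · exact (S.side_sqLoop_neg (S.neg_eighth_lt_of_mem_ball ht hzb).le h0).le

/-- Gate-`0` points have `side = 0` and `sqn ≤ r`. [folklore] -/
theorem side_eq_zero_of_mem_gate_zero {z : ℂ} (hz : z ∈ S.gate 0) : S.side z = 0 ∧ sqn z ≤ S.r := by
  obtain ⟨t, ht, rfl⟩ := S.mem_gate_zero_iff.1 hz
  refine ⟨S.side_smul_x t, ?_⟩
  rw [S.sqn_smul_x ht.1.le]
  nlinarith [S.r_pos, ht.2]

/-- Points of gates `1`, `2` have `sqn = r`. [folklore] -/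
theorem sqn_eq_of_mem_gate {m : Fin 3} (hm : m ≠ 0) {z : ℂ} (hz : z ∈ S.gate m) : sqn z = S.r := by
  match m with
  | 0 => exact absurd rfl hm
  | 1 =>
    obtain ⟨t, -, rfl⟩ : z ∈ S.sqLoop '' Ico 0 S.tauP := hz
    exact S.sqn_sqLoop t
  | 2 =>
    obtain ⟨t, -, rfl⟩ : z ∈ S.sqLoop '' Ioc S.tauM 0 := hz
    exact S.sqn_sqLoop t

/-! ### The germs `P_m`, `P'_m` -/

/-- **The germ `P_m` at `x` of the chamber `K_m`** (the chamber not bounded by gate `m`):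
`P_0 = B(x,ρ) ∩ {sqn > r}`, `P_1 = B(x,ρ) ∩ Q' ∩ {side < 0}`, `P_2 = B(x,ρ) ∩ Q' ∩ {side > 0}`.
[cite: LawlerSchrammWerner2004, proof of Lemma 5.4] -/
def regP : Fin 3 → ℝ → Set ℂ
  | 0, ρ => ball S.x ρ ∩ {z | S.r < sqn z}
  | 1, ρ => ball S.x ρ ∩ {z | sqn z < S.r} ∩ {z | S.side z < 0}
  | 2, ρ => ball S.x ρ ∩ {z | sqn z < S.r} ∩ {z | 0 < S.side z}

/-- **The complementary germ `P'_m`** (the other two sectors, joined through gate `m`):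
`P'_0 = B(x,ρ) ∩ Q'`, `P'_1 = B(x,ρ) ∩ ({side > 0} ∪ {sqn > r})`,
`P'_2 = B(x,ρ) ∩ ({side < 0} ∪ {sqn > r})`. [cite: LawlerSchrammWerner2004, proof of Lemma 5.4] -/
def regP' : Fin 3 → ℝ → Set ℂ
  | 0, ρ => ball S.x ρ ∩ {z | sqn z < S.r}
  | 1, ρ => ball S.x ρ ∩ ({z | 0 < S.side z} ∪ {z | S.r < sqn z})
  | 2, ρ => ball S.x ρ ∩ ({z | S.side z < 0} ∪ {z | S.r < sqn z})

/-- Unfolding `P_0`. [folklore] -/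
theorem regP_zero (ρ : ℝ) : S.regP 0 ρ = ball S.x ρ ∩ {z | S.r < sqn z} := rfl
/-- Unfolding `P_1`. [folklore] -/
theorem regP_one (ρ : ℝ) : S.regP 1 ρ = ball S.x ρ ∩ {z | sqn z < S.r} ∩ {z | S.side z < 0} := rfl
/-- Unfolding `P_2`. [folklore] -/
theorem regP_two (ρ : ℝ) : S.regP 2 ρ = ball S.x ρ ∩ {z | sqn z < S.r} ∩ {z | 0 < S.side z} := rfl
/-- Unfolding `P'_0`. [folklore] -/
theorem regP'_zero (ρ : ℝ) : S.regP' 0 ρ = ball S.x ρ ∩ {z | sqn z < S.r} := rfl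
/-- Unfolding `P'_1`. [folklore] -/
theorem regP'_one (ρ : ℝ) :
    S.regP' 1 ρ = ball S.x ρ ∩ ({z | 0 < S.side z} ∪ {z | S.r < sqn z}) := rfl
/-- Unfolding `P'_2`. [folklore] -/
theorem regP'_two (ρ : ℝ) :
    S.regP' 2 ρ = ball S.x ρ ∩ ({z | S.side z < 0} ∪ {z | S.r < sqn z}) := rfl

/-- `P_m ⊆ B(x, ρ)`. [folklore] -/
theorem regP_subset_ball (m : Fin 3) (ρ : ℝ) : S.regP m ρ ⊆ ball S.x ρ := by
  match m with
  | 0 => exact inter_subset_left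
  | 1 => exact inter_subset_left.trans inter_subset_left
  | 2 => exact inter_subset_left.trans inter_subset_left

/-- `P'_m ⊆ B(x, ρ)`. [folklore] -/
theorem regP'_subset_ball (m : Fin 3) (ρ : ℝ) : S.regP' m ρ ⊆ ball S.x ρ := by
  match m with
  | 0 => exact inter_subset_left
  | 1 => exact inter_subset_left
  | 2 => exact inter_subset_left

/-- The linear functional `side`. [folklore] -/
theorem side_eq_lin (z : ℂ) : S.side z = (S.r • Complex.imLm - S.a • Complex.reLm) z := by
  simp [side]

/-- `{side < 0}` is convex. [folklore] -/
theorem convex_side_neg : Convex ℝ {z : ℂ | S.side z < 0} := by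
  have : {z : ℂ | S.side z < 0} = {z | (S.r • Complex.imLm - S.a • Complex.reLm) z < 0} := by
    ext z; rw [mem_setOf_eq, mem_setOf_eq, S.side_eq_lin]
  rw [this]
  exact convex_halfSpace_lt (S.r • Complex.imLm - S.a • Complex.reLm).isLinear 0

/-- `{side > 0}` is convex. [folklore] -/
theorem convex_side_pos : Convex ℝ {z : ℂ | 0 < S.side z} := by
  have : {z : ℂ | 0 < S.side z} = {z | 0 < (S.r • Complex.imLm - S.a • Complex.reLm) z} := by
    ext z; rw [mem_setOf_eq, mem_setOf_eq, S.side_eq_lin]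
  rw [this]
  exact convex_halfSpace_gt (S.r • Complex.imLm - S.a • Complex.reLm).isLinear 0

/-- `P_m` is preconnected (`0 < ρ ≤ r`). [folklore] -/
theorem isPreconnected_regP (m : Fin 3) {ρ : ℝ} (hρ0 : 0 < ρ) (hρ : ρ ≤ S.r) :
    IsPreconnected (S.regP m ρ) := by
  match m with
  | 0 => exact S.isPreconnected_ball_inter_sqn_gt hρ0 hρ
  | 1 => exact (((convex_ball _ _).inter (convex_sqn_lt S.r)).inter S.convex_side_neg).isPreconnected
  | 2 => exact (((convex_ball _ _).inter (convex_sqn_lt S.r)).inter S.convex_side_pos).isPreconnected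

/-- `P'_m` is preconnected (`0 < ρ ≤ r`). [folklore] -/
theorem isPreconnected_regP' (m : Fin 3) {ρ : ℝ} (hρ0 : 0 < ρ) (hρ : ρ ≤ S.r) :
    IsPreconnected (S.regP' m ρ) := by
  match m with
  | 0 => exact S.isPreconnected_ball_inter_sqn_lt ρ
  | 1 => exact S.isPreconnected_ball_inter_side_pos_union hρ0 hρ
  | 2 => exact S.isPreconnected_ball_inter_side_neg_union hρ0 hρ

/-- Points of `G` have `sqn = r`, or `side = 0` and `sqn ≤ r`. [folklore] -/
theorem sqn_eq_or_of_mem_G {z : ℂ} (hz : z ∈ S.G) : sqn z = S.r ∨ (S.side z = 0 ∧ sqn z ≤ S.r) := by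
  rcases hz with hseg | hsq
  · right
    obtain ⟨t, ht, rfl⟩ := S.mem_segment_iff.1 hseg
    refine ⟨S.side_smul_x t, ?_⟩
    rw [S.sqn_smul_x ht.1]
    nlinarith [S.r_pos, ht.2]
  · exact Or.inl hsq

/-- `P_m` avoids the gate set `G`. [folklore] -/
theorem regP_disjoint_G (m : Fin 3) (ρ : ℝ) : Disjoint (S.regP m ρ) S.G := by
  rw [Set.disjoint_left]
  intro z hz hzG
  have hG := S.sqn_eq_or_of_mem_G hzG
  match m with
  | 0 =>
    have h : S.r < sqn z := hz.2
    rcases hG with h1 | ⟨-, h1⟩ <;> linarith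
  | 1 =>
    have h1 : sqn z < S.r := hz.1.2
    have h2 : S.side z < 0 := hz.2
    rcases hG with h3 | ⟨h3, -⟩ <;> linarith
  | 2 =>
    have h1 : sqn z < S.r := hz.1.2
    have h2 : 0 < S.side z := hz.2
    rcases hG with h3 | ⟨h3, -⟩ <;> linarith

/-- **`P'_m` meets no gate other than `m`** (for `ρ ≤ ρ₀`). [folklore] -/
theorem not_mem_gate_of_mem_regP' {m i : Fin 3} (him : i ≠ m) {ρ : ℝ} (hρ : ρ ≤ S.rho) {z : ℂ}
    (hz : z ∈ S.regP' m ρ) (hzi : z ∈ S.gate i) : False := by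
  have hzb : z ∈ ball S.x S.rho := ball_subset_ball hρ (S.regP'_subset_ball m ρ hz)
  match m, i with
  | 0, 0 => exact him rfl
  | 1, 1 => exact him rfl
  | 2, 2 => exact him rfl
  | 0, 1 =>
    have h1 : sqn z < S.r := hz.2
    linarith [S.sqn_eq_of_mem_gate one_ne_zero hzi]
  | 0, 2 =>
    have h1 : sqn z < S.r := hz.2
    linarith [S.sqn_eq_of_mem_gate (by decide) hzi]
  | 1, 0 =>
    obtain ⟨h1, h2⟩ := S.side_eq_zero_of_mem_gate_zero hzi
    rcases hz.2 with h | h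
    · exact absurd h1 (ne_of_gt h)
    · exact absurd h2 (not_le.2 h)
  | 2, 0 =>
    obtain ⟨h1, h2⟩ := S.side_eq_zero_of_mem_gate_zero hzi
    rcases hz.2 with h | h
    · exact absurd h1 (ne_of_lt h)
    · exact absurd h2 (not_le.2 h)
  | 1, 2 =>
    have h1 := S.side_nonpos_of_mem_gate_two hzi hzb
    have h2 := S.sqn_eq_of_mem_gate (by decide) hzi
    rcases hz.2 with h | h
    · exact absurd h1 (not_le.2 h)
    · exact absurd h2 (ne_of_gt h)
  | 2, 1 =>
    have h1 := S.side_nonneg_of_mem_gate_one hzi hzb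
    have h2 := S.sqn_eq_of_mem_gate one_ne_zero hzi
    rcases hz.2 with h | h
    · exact absurd h1 (not_le.2 h)
    · exact absurd h2 (ne_of_gt h)

/-- **`B(x, ρ) ∖ G ⊆ P_m ∪ P'_m`** (`ρ ≤ r`). [folklore] -/
theorem mem_regP_or_regP' (m : Fin 3) {ρ : ℝ} (hρ : ρ ≤ S.r) {z : ℂ} (hz : z ∈ ball S.x ρ)
    (hzG : z ∉ S.G) : z ∈ S.regP m ρ ∨ z ∈ S.regP' m ρ := by
  have hsq : sqn z ≠ S.r := fun h ↦ hzG (Or.inr h)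
  rcases lt_or_gt_of_ne hsq with hlt | hgt
  · have hside := S.side_ne_zero_of_notMem_G hρ hz hzG hlt
    rcases lt_or_gt_of_ne hside with hneg | hpos
    · match m with
      | 0 => exact Or.inr (show z ∈ ball S.x ρ ∩ {z | sqn z < S.r} from ⟨hz, hlt⟩)
      | 1 => exact Or.inl (show z ∈ ball S.x ρ ∩ {z | sqn z < S.r} ∩ {z | S.side z < 0} from
          ⟨⟨hz, hlt⟩, hneg⟩)
      | 2 => exact Or.inr (show z ∈ ball S.x ρ ∩ ({z | S.side z < 0} ∪ {z | S.r < sqn z}) from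
          ⟨hz, Or.inl hneg⟩)
    · match m with
      | 0 => exact Or.inr (show z ∈ ball S.x ρ ∩ {z | sqn z < S.r} from ⟨hz, hlt⟩)
      | 1 => exact Or.inr (show z ∈ ball S.x ρ ∩ ({z | 0 < S.side z} ∪ {z | S.r < sqn z}) from
          ⟨hz, Or.inl hpos⟩)
      | 2 => exact Or.inl (show z ∈ ball S.x ρ ∩ {z | sqn z < S.r} ∩ {z | 0 < S.side z} from
          ⟨⟨hz, hlt⟩, hpos⟩)
  · match m with
    | 0 => exact Or.inl (show z ∈ ball S.x ρ ∩ {z | S.r < sqn z} from ⟨hz, hgt⟩)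
    | 1 => exact Or.inr (show z ∈ ball S.x ρ ∩ ({z | 0 < S.side z} ∪ {z | S.r < sqn z}) from
        ⟨hz, Or.inr hgt⟩)
    | 2 => exact Or.inr (show z ∈ ball S.x ρ ∩ ({z | S.side z < 0} ∪ {z | S.r < sqn z}) from
        ⟨hz, Or.inr hgt⟩)

/-- `V_m ∩ B(x, ρ) ⊆ P_m`. [folklore] -/
theorem V_inter_ball_subset_regP (m : Fin 3) (ρ : ℝ) : S.V m ∩ ball S.x ρ ⊆ S.regP m ρ := by
  rintro z ⟨hzV, hzb⟩
  match m with
  | 0 =>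
    have h : S.r < z.re := hzV.2
    exact show z ∈ ball S.x ρ ∩ {z | S.r < sqn z} from
      ⟨hzb, lt_of_lt_of_le (h.trans_le (le_abs_self _)) (le_max_left _ _)⟩
  | 1 =>
    have h1 : sqn z < S.r := hzV.1.2
    have h2 : S.side z < 0 := hzV.2
    exact show z ∈ ball S.x ρ ∩ {z | sqn z < S.r} ∩ {z | S.side z < 0} from ⟨⟨hzb, h1⟩, h2⟩
  | 2 =>
    have h1 : sqn z < S.r := hzV.1.2
    have h2 : 0 < S.side z := hzV.2
    exact show z ∈ ball S.x ρ ∩ {z | sqn z < S.r} ∩ {z | 0 < S.side z} from ⟨⟨hzb, h1⟩, h2⟩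

/-- `V_l ∩ B(x, ρ) ⊆ P'_m` for `l ≠ m`. [folklore] -/
theorem V_inter_ball_subset_regP' {l m : Fin 3} (hlm : l ≠ m) (ρ : ℝ) :
    S.V l ∩ ball S.x ρ ⊆ S.regP' m ρ := by
  rintro z ⟨hzV, hzb⟩
  match m, l with
  | 0, 0 => exact absurd rfl hlm
  | 1, 1 => exact absurd rfl hlm
  | 2, 2 => exact absurd rfl hlm
  | 0, 1 =>
    have h1 : sqn z < S.r := hzV.1.2
    exact show z ∈ ball S.x ρ ∩ {z | sqn z < S.r} from ⟨hzb, h1⟩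
  | 0, 2 =>
    have h1 : sqn z < S.r := hzV.1.2
    exact show z ∈ ball S.x ρ ∩ {z | sqn z < S.r} from ⟨hzb, h1⟩
  | 1, 0 =>
    have h : S.r < z.re := hzV.2
    exact show z ∈ ball S.x ρ ∩ ({z | 0 < S.side z} ∪ {z | S.r < sqn z}) from
      ⟨hzb, Or.inr (lt_of_lt_of_le (h.trans_le (le_abs_self _)) (le_max_left _ _))⟩
  | 2, 0 =>
    have h : S.r < z.re := hzV.2
    exact show z ∈ ball S.x ρ ∩ ({z | S.side z < 0} ∪ {z | S.r < sqn z}) from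
      ⟨hzb, Or.inr (lt_of_lt_of_le (h.trans_le (le_abs_self _)) (le_max_left _ _))⟩
  | 1, 2 =>
    have h2 : 0 < S.side z := hzV.2
    exact show z ∈ ball S.x ρ ∩ ({z | 0 < S.side z} ∪ {z | S.r < sqn z}) from ⟨hzb, Or.inl h2⟩
  | 2, 1 =>
    have h2 : S.side z < 0 := hzV.2
    exact show z ∈ ball S.x ρ ∩ ({z | S.side z < 0} ∪ {z | S.r < sqn z}) from ⟨hzb, Or.inl h2⟩

/-- **The regions `V_m` reach `x`**: `V_m ∩ B(x, ρ) ≠ ∅` for every `ρ > 0` (explicit points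
`x + δ w_m` with `w_0 = 1`, `w_1 = -1 - (a/r + ½) i`, `w_2 = -1 - (a/r - ½) i`). [folklore] -/
theorem V_inter_ball_nonempty (m : Fin 3) {ρ : ℝ} (hρ0 : 0 < ρ) : (S.V m ∩ ball S.x ρ).Nonempty := by
  have hr := S.r_pos
  have ha0 := S.a_nonneg
  have ha1 := S.a_le
  set δ : ℝ := min ρ S.r / 4 with hδ
  have hδ0 : 0 < δ := by positivity
  have hδρ : δ ≤ ρ / 4 := by
    have := min_le_left ρ S.r; rw [hδ]; linarith
  have hδr : δ ≤ S.r / 4 := by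
    have := min_le_right ρ S.r; rw [hδ]; linarith
  -- the witness `x + δ (-1 + s i)` for `m = 1, 2`, `x + δ` for `m = 0`
  have key : ∀ s : ℝ, |s| ≤ 3 / 2 → S.a + s * δ < S.r →
      S.x + (δ : ℂ) * (-1 + (s : ℂ) * I) ∈ S.B₀ ∩ {z | sqn z < S.r} ∩ ball S.x ρ ∧
        S.side (S.x + (δ : ℂ) * (-1 + (s : ℂ) * I)) = δ * (S.r * s + S.a) ∧
        (S.x + (δ : ℂ) * (-1 + (s : ℂ) * I)).im = S.a + s * δ := by
    intro s hs hs2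
    have hnorm : ‖(δ : ℂ) * (-1 + (s : ℂ) * I)‖ ≤ δ * (5 / 2) := by
      rw [norm_mul, Complex.norm_real, Real.norm_eq_abs, abs_of_pos hδ0]
      refine mul_le_mul_of_nonneg_left ?_ hδ0.le
      calc ‖(-1 : ℂ) + (s : ℂ) * I‖ ≤ ‖(-1 : ℂ)‖ + ‖(s : ℂ) * I‖ := norm_add_le _ _
        _ = 1 + |s| := by simp
        _ ≤ 5 / 2 := by linarith
    have hre : (S.x + (δ : ℂ) * (-1 + (s : ℂ) * I)).re = S.r - δ := by simp [x_re]; ring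
    have him : (S.x + (δ : ℂ) * (-1 + (s : ℂ) * I)).im = S.a + s * δ := by simp [x_im]; ring
    refine ⟨⟨⟨?_, ?_⟩, ?_⟩, ?_, him⟩
    · show S.x + (δ : ℂ) * (-1 + (s : ℂ) * I) ∈ ball S.x (9 * S.r / 10)
      rw [mem_ball, dist_eq_norm, add_sub_cancel_left]
      linarith
    · show sqn (S.x + (δ : ℂ) * (-1 + (s : ℂ) * I)) < S.r
      rw [sqn, hre, him, max_lt_iff, abs_lt, abs_lt]
      have h1 : s * δ ≤ 3 / 2 * δ := by nlinarith [le_abs_self s]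
      have h2 : -(3 / 2 * δ) ≤ s * δ := by nlinarith [neg_abs_le s]
      exact ⟨⟨by linarith, by linarith⟩, by nlinarith, hs2⟩
    · rw [mem_ball, dist_eq_norm, add_sub_cancel_left]
      linarith
    · rw [side, hre, him]; ring
  match m with
  | 0 =>
    refine ⟨S.x + (δ : ℂ), ⟨?_, ?_⟩, ?_⟩
    · show S.x + (δ : ℂ) ∈ ball S.x (9 * S.r / 10)
      rw [mem_ball, dist_eq_norm, add_sub_cancel_left, Complex.norm_real, Real.norm_eq_abs,
        abs_of_pos hδ0]
      linarith
    · show S.r < (S.x + (δ : ℂ)).re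
      simp [x_re, hδ0]
    · rw [mem_ball, dist_eq_norm, add_sub_cancel_left, Complex.norm_real, Real.norm_eq_abs,
        abs_of_pos hδ0]
      linarith
  | 1 =>
    set s : ℝ := -(S.a / S.r) - 1 / 2 with hs
    have har : 0 ≤ S.a / S.r ∧ S.a / S.r ≤ 1 :=
      ⟨div_nonneg ha0 hr.le, (div_le_one hr).2 ha1⟩
    have hs' : |s| ≤ 3 / 2 := by rw [hs, abs_le]; constructor <;> linarith [har.1, har.2]
    have hs2 : S.a + s * δ < S.r := by
      have : s * δ < 0 := mul_neg_of_neg_of_pos (by rw [hs]; linarith [har.1]) hδ0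
      linarith
    obtain ⟨⟨⟨hB, hsq⟩, hb⟩, hside, -⟩ := key s hs' hs2
    refine ⟨_, ⟨⟨hB, hsq⟩, ?_⟩, hb⟩
    show S.side (S.x + (δ : ℂ) * (-1 + (s : ℂ) * I)) < 0
    rw [hside, hs]
    have : S.r * (-(S.a / S.r) - 1 / 2) + S.a = -(S.r / 2) := by field_simp; ring
    rw [this]; nlinarith
  | 2 =>
    set s : ℝ := -(S.a / S.r) + 1 / 2 with hs
    have har : 0 ≤ S.a / S.r ∧ S.a / S.r ≤ 1 :=
      ⟨div_nonneg ha0 hr.le, (div_le_one hr).2 ha1⟩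
    have hs' : |s| ≤ 3 / 2 := by rw [hs, abs_le]; constructor <;> linarith [har.1, har.2]
    have hs2 : S.a + s * δ < S.r := by
      -- `r - (a + s δ) = (r - a)(1 - δ/r) + δ/2 > 0`
      have h1 : S.a + s * δ = S.a * (1 - δ / S.r) + δ / 2 := by rw [hs]; field_simp; ring
      have h2 : 0 ≤ 1 - δ / S.r := by
        rw [sub_nonneg, div_le_one hr]; linarith
      have h3 : S.a * (1 - δ / S.r) ≤ S.r * (1 - δ / S.r) := mul_le_mul_of_nonneg_right ha1 h2
      have h4 : S.r * (1 - δ / S.r) = S.r - δ := by field_simp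
      linarith
    obtain ⟨⟨⟨hB, hsq⟩, hb⟩, hside, -⟩ := key s hs' hs2
    refine ⟨_, ⟨⟨hB, hsq⟩, ?_⟩, hb⟩
    show 0 < S.side (S.x + (δ : ℂ) * (-1 + (s : ℂ) * I))
    rw [hside, hs]
    have : S.r * (-(S.a / S.r) + 1 / 2) + S.a = S.r / 2 := by field_simp; ring
    rw [this]; positivity

/-- `V_m` meets `P_m`. [folklore] -/
theorem V_inter_regP_nonempty (m : Fin 3) {ρ : ℝ} (hρ0 : 0 < ρ) : (S.V m ∩ S.regP m ρ).Nonempty := by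
  obtain ⟨z, hzV, hzb⟩ := S.V_inter_ball_nonempty m hρ0
  exact ⟨z, hzV, S.V_inter_ball_subset_regP m ρ ⟨hzV, hzb⟩⟩

/-- `V_l` meets `P'_m` for `l ≠ m`. [folklore] -/
theorem V_inter_regP'_nonempty {l m : Fin 3} (hlm : l ≠ m) {ρ : ℝ} (hρ0 : 0 < ρ) :
    (S.V l ∩ S.regP' m ρ).Nonempty := by
  obtain ⟨z, hzV, hzb⟩ := S.V_inter_ball_nonempty l hρ0
  exact ⟨z, hzV, S.V_inter_ball_subset_regP' hlm ρ ⟨hzV, hzb⟩⟩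

/-- `σ t ∈ B(x, ρ)` for `t` near `0`. [folklore] -/
theorem sqLoop_eventually_mem_ball {ρ : ℝ} (hρ0 : 0 < ρ) : ∀ᶠ t in 𝓝 (0 : ℝ), S.sqLoop t ∈ ball S.x ρ := by
  have h : ContinuousAt S.sqLoop 0 := S.continuous_sqLoop.continuousAt
  have : ball S.x ρ ∈ 𝓝 (S.sqLoop 0) := by rw [sqLoop_zero]; exact isOpen_ball.mem_nhds (mem_ball_self hρ0)
  exact h.preimage_mem_nhds this

/-- **Gate `m` enters `P'_m`**: `(gate m ∖ {x}) ∩ P'_m ≠ ∅` for every `ρ > 0`. [folklore] -/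
theorem gate_inter_regP'_nonempty (m : Fin 3) {ρ : ℝ} (hρ0 : 0 < ρ) :
    ((S.gate m \ {S.x}) ∩ S.regP' m ρ).Nonempty := by
  have hr := S.r_pos
  obtain ⟨hP, -, -⟩ := S.tauP_spec
  obtain ⟨hM, -, -⟩ := S.tauM_spec
  match m with
  | 0 =>
    -- `(1 - δ') x`
    have hx2 : ‖S.x‖ ≤ 2 * S.r := by
      have h1 : ‖S.x‖ ^ 2 ≤ 2 * sqn S.x ^ 2 := norm_sq_le_two_mul_sqn_sq S.x
      rw [S.sqn_x] at h1
      nlinarith [norm_nonneg S.x]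
    set δ' : ℝ := min (1 / 2) (ρ / (4 * S.r)) with hδ'
    have hδ'0 : 0 < δ' := by positivity
    have hδ'1 : δ' ≤ 1 / 2 := min_le_left _ _
    have hδ'2 : δ' * ‖S.x‖ < ρ := by
      have : δ' ≤ ρ / (4 * S.r) := min_le_right _ _
      calc δ' * ‖S.x‖ ≤ ρ / (4 * S.r) * (2 * S.r) := by gcongr
        _ = ρ / 2 := by field_simp; ring
        _ < ρ := by linarith
    refine ⟨((1 - δ' : ℝ) : ℂ) * S.x, ⟨?_, ?_⟩, ?_⟩
    · exact S.mem_gate_zero_iff.2 ⟨1 - δ', ⟨by linarith, by linarith⟩, rfl⟩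
    · intro h
      rw [mem_singleton_iff] at h
      have h2 : ((1 - δ' : ℝ) : ℂ) * S.x = (1 : ℂ) * S.x := by rw [one_mul]; exact h
      have h3 := mul_right_cancel₀ (norm_pos_iff.1 S.norm_x_pos) h2
      have h4 : (1 - δ' : ℝ) = 1 := by exact_mod_cast h3
      linarith
    · show ((1 - δ' : ℝ) : ℂ) * S.x ∈ ball S.x ρ ∩ {z | sqn z < S.r}
      constructor
      · rw [mem_ball, dist_eq_norm, show ((1 - δ' : ℝ) : ℂ) * S.x - S.x = -((δ' : ℂ) * S.x) by
          push_cast; ring, norm_neg, norm_mul, Complex.norm_real, Real.norm_eq_abs, abs_of_pos hδ'0]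
        exact hδ'2
      · show sqn (((1 - δ' : ℝ) : ℂ) * S.x) < S.r
        rw [S.sqn_smul_x (by linarith)]
        nlinarith
  | 1 =>
    -- `σ t`, `t > 0` small
    obtain ⟨δ₀, hδ₀, hball⟩ := Metric.eventually_nhds_iff.1 (S.sqLoop_eventually_mem_ball hρ0)
    set t : ℝ := min (δ₀ / 2) (min (S.tauP / 2) (1 / 4)) with ht
    have ht0 : 0 < t := by rw [ht]; exact lt_min (by linarith) (lt_min (by linarith [hP.1]) (by norm_num))
    have ht1 : t < δ₀ := lt_of_le_of_lt (min_le_left _ _) (by linarith)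
    have ht2 : t < S.tauP := lt_of_le_of_lt ((min_le_right _ _).trans (min_le_left _ _)) (by linarith [hP.1])
    have ht3 : t ≤ 1 / 4 := (min_le_right _ _).trans (min_le_right _ _)
    have hb : S.sqLoop t ∈ ball S.x ρ := hball (by rw [dist_zero_right, Real.norm_eq_abs, abs_of_pos ht0]; exact ht1)
    refine ⟨S.sqLoop t, ⟨⟨t, ⟨ht0.le, ht2⟩, rfl⟩, ?_⟩, ?_⟩
    · rw [mem_singleton_iff]; exact S.sqLoop_ne_x (by linarith [hM.2]) ht2 ht0.ne'
    · show S.sqLoop t ∈ ball S.x ρ ∩ ({z | 0 < S.side z} ∪ {z | S.r < sqn z})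
      exact ⟨hb, Or.inl (S.side_sqLoop_pos ht0 ht3)⟩
  | 2 =>
    obtain ⟨δ₀, hδ₀, hball⟩ := Metric.eventually_nhds_iff.1 (S.sqLoop_eventually_mem_ball hρ0)
    set t : ℝ := -min (δ₀ / 2) (min (-S.tauM / 2) (1 / 8)) with ht
    have hmin : 0 < min (δ₀ / 2) (min (-S.tauM / 2) (1 / 8)) :=
      lt_min (by linarith) (lt_min (by linarith [hM.2]) (by norm_num))
    have ht0 : t < 0 := by rw [ht]; linarith
    have ht1 : -δ₀ < t := by
      have := min_le_left (δ₀ / 2) (min (-S.tauM / 2) (1 / 8)); rw [ht]; linarith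
    have ht2 : S.tauM < t := by
      have := (min_le_right (δ₀ / 2) _).trans (min_le_left (-S.tauM / 2) (1 / 8 : ℝ))
      rw [ht]; linarith [hM.2]
    have ht3 : -(1 / 8 : ℝ) ≤ t := by
      have := (min_le_right (δ₀ / 2) _).trans (min_le_right (-S.tauM / 2) (1 / 8 : ℝ))
      rw [ht]; linarith
    have hb : S.sqLoop t ∈ ball S.x ρ := hball (by
      rw [dist_zero_right, Real.norm_eq_abs, abs_of_neg ht0]; linarith)
    refine ⟨S.sqLoop t, ⟨⟨t, ⟨ht2, ht0.le⟩, rfl⟩, ?_⟩, ?_⟩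
    · rw [mem_singleton_iff]; exact S.sqLoop_ne_x ht2 (by linarith [hP.1]) ht0.ne
    · show S.sqLoop t ∈ ball S.x ρ ∩ ({z | S.side z < 0} ∪ {z | S.r < sqn z})
      exact ⟨hb, Or.inl (S.side_sqLoop_neg ht3 ht0)⟩

/-! ### The approach paths -/

/-- **The approach paths**: `A_0 t = (1 - t) x` (down the segment to `0`), `A_1 t = σ (τ₊ t)`,
`A_2 t = σ (τ₋ t)`; each maps `[0, 1)` injectively onto gate `m` and ends at a point of `∂Ω`.
[cite: LawlerSchrammWerner2004, proof of Lemma 5.4] -/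
def apr : Fin 3 → ℝ → ℂ
  | 0 => fun t ↦ ((1 - t : ℝ) : ℂ) * S.x
  | 1 => fun t ↦ S.sqLoop (S.tauP * t)
  | 2 => fun t ↦ S.sqLoop (S.tauM * t)

/-- The boundary endpoints `A_m 1`: `0`, `σ τ₊`, `σ τ₋`. [folklore] -/
def aprEnd : Fin 3 → ℂ
  | 0 => 0
  | 1 => S.sqLoop S.tauP
  | 2 => S.sqLoop S.tauM

/-- Unfolding `A_0`. [folklore] -/
theorem apr_zero_apply (t : ℝ) : S.apr 0 t = ((1 - t : ℝ) : ℂ) * S.x := rfl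
/-- Unfolding `A_1`. [folklore] -/
theorem apr_one_apply (t : ℝ) : S.apr 1 t = S.sqLoop (S.tauP * t) := rfl
/-- Unfolding `A_2`. [folklore] -/
theorem apr_two_apply (t : ℝ) : S.apr 2 t = S.sqLoop (S.tauM * t) := rfl

/-- The approach paths are continuous. [folklore] -/
theorem continuous_apr (m : Fin 3) : Continuous (S.apr m) := by
  match m with
  | 0 => show Continuous fun t : ℝ ↦ ((1 - t : ℝ) : ℂ) * S.x; fun_prop
  | 1 => exact S.continuous_sqLoop.comp (continuous_const.mul continuous_id)
  | 2 => exact S.continuous_sqLoop.comp (continuous_const.mul continuous_id)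

/-- `A_m 0 = x`. [folklore] -/
theorem apr_zero (m : Fin 3) : S.apr m 0 = S.x := by
  match m with
  | 0 => simp [apr_zero_apply]
  | 1 => rw [apr_one_apply, mul_zero, sqLoop_zero]
  | 2 => rw [apr_two_apply, mul_zero, sqLoop_zero]

/-- `A_m 1` is the boundary endpoint. [folklore] -/
theorem apr_one (m : Fin 3) : S.apr m 1 = S.aprEnd m := by
  match m with
  | 0 => simp [apr_zero_apply, aprEnd]
  | 1 => show S.sqLoop (S.tauP * 1) = S.sqLoop S.tauP; rw [mul_one]
  | 2 => show S.sqLoop (S.tauM * 1) = S.sqLoop S.tauM; rw [mul_one]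

/-- The boundary endpoints are not in `Ω`. [folklore] -/
theorem aprEnd_notMem (m : Fin 3) : S.aprEnd m ∉ S.Ω := by
  match m with
  | 0 => exact S.zero_notMem
  | 1 => exact S.tauP_spec.2.1
  | 2 => exact S.tauM_spec.2.1

/-- `A_m` tends to its boundary endpoint at `1`. [folklore] -/
theorem tendsto_apr (m : Fin 3) : Tendsto (S.apr m) (𝓝[<] 1) (𝓝 (S.aprEnd m)) := by
  rw [← apr_one]
  exact ((S.continuous_apr m).tendsto 1).mono_left nhdsWithin_le_nhds

/-- `A_m [0, 1) ⊆ gate m`. [folklore] -/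
theorem apr_mem_gate (m : Fin 3) {t : ℝ} (ht : t ∈ Ico (0 : ℝ) 1) : S.apr m t ∈ S.gate m := by
  obtain ⟨hP, -, -⟩ := S.tauP_spec
  obtain ⟨hM, -, -⟩ := S.tauM_spec
  match m with
  | 0 => exact S.mem_gate_zero_iff.2 ⟨1 - t, ⟨by linarith [ht.2], by linarith [ht.1]⟩, rfl⟩
  | 1 =>
    refine ⟨S.tauP * t, ⟨mul_nonneg hP.1.le ht.1, ?_⟩, rfl⟩
    nlinarith [hP.1, ht.2]
  | 2 =>
    refine ⟨S.tauM * t, ⟨?_, ?_⟩, rfl⟩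
    · nlinarith [hM.2, ht.2]
    · nlinarith [hM.2, ht.1]

/-- `A_m [0, 1) ⊆ Ω`. [folklore] -/
theorem apr_mem_Ω (m : Fin 3) {t : ℝ} (ht : t ∈ Ico (0 : ℝ) 1) : S.apr m t ∈ S.Ω :=
  S.gate_subset_Ω m (S.apr_mem_gate m ht)

/-- `gate m ⊆ A_m [0, 1)`. [folklore] -/
theorem exists_apr_eq (m : Fin 3) {z : ℂ} (hz : z ∈ S.gate m) : ∃ t ∈ Ico (0 : ℝ) 1, S.apr m t = z := by
  obtain ⟨hP, -, -⟩ := S.tauP_spec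
  obtain ⟨hM, -, -⟩ := S.tauM_spec
  match m with
  | 0 =>
    obtain ⟨s, hs, rfl⟩ := S.mem_gate_zero_iff.1 hz
    refine ⟨1 - s, ⟨by linarith [hs.2], by linarith [hs.1]⟩, ?_⟩
    rw [apr_zero_apply]; push_cast; ring_nf
  | 1 =>
    obtain ⟨u, hu, rfl⟩ : z ∈ S.sqLoop '' Ico 0 S.tauP := hz
    refine ⟨u / S.tauP, ⟨div_nonneg hu.1 hP.1.le, (div_lt_one hP.1).2 hu.2⟩, ?_⟩
    rw [apr_one_apply, mul_div_cancel₀ _ hP.1.ne']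
  | 2 =>
    obtain ⟨u, hu, rfl⟩ : z ∈ S.sqLoop '' Ioc S.tauM 0 := hz
    refine ⟨u / S.tauM, ⟨div_nonneg_of_nonpos hu.2 hM.2.le, (div_lt_one_of_neg hM.2).2 hu.1⟩, ?_⟩
    rw [apr_two_apply, mul_div_cancel₀ _ hM.2.ne]

/-- `A_m` is injective on `[0, 1)`. [folklore] -/
theorem injOn_apr (m : Fin 3) : InjOn (S.apr m) (Ico 0 1) := by
  obtain ⟨hP, -, -⟩ := S.tauP_spec
  obtain ⟨hM, -, -⟩ := S.tauM_spec
  intro s hs t ht hst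
  match m with
  | 0 =>
    rw [apr_zero_apply, apr_zero_apply] at hst
    have h := mul_right_cancel₀ (norm_pos_iff.1 S.norm_x_pos) hst
    have : (1 - s : ℝ) = 1 - t := by exact_mod_cast h
    linarith
  | 1 =>
    rw [apr_one_apply, apr_one_apply] at hst
    have hmax : max s t < 1 := max_lt hs.2 ht.2
    have hlt : S.tauP * max s t < S.tauP := by nlinarith [hP.1]
    have h := S.injOn_sqLoop (s := 0) (t := S.tauP * max s t) (by linarith [hM.2]) hlt
      ⟨mul_nonneg hP.1.le hs.1, mul_le_mul_of_nonneg_left (le_max_left _ _) hP.1.le⟩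
      ⟨mul_nonneg hP.1.le ht.1, mul_le_mul_of_nonneg_left (le_max_right _ _) hP.1.le⟩ hst
    have := mul_left_cancel₀ hP.1.ne' h
    exact this
  | 2 =>
    rw [apr_two_apply, apr_two_apply] at hst
    have hmax : max s t < 1 := max_lt hs.2 ht.2
    have hlt : S.tauM < S.tauM * max s t := by nlinarith [hM.2]
    have h := S.injOn_sqLoop (s := S.tauM * max s t) (t := 0) hlt hP.1
      ⟨mul_le_mul_of_nonpos_left (le_max_left _ _) hM.2.le, mul_nonpos_of_nonpos_of_nonneg hM.2.le hs.1⟩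
      ⟨mul_le_mul_of_nonpos_left (le_max_right _ _) hM.2.le, mul_nonpos_of_nonpos_of_nonneg hM.2.le ht.1⟩
      hst
    exact mul_left_cancel₀ hM.2.ne h

/-- `A_m t = x` only for `t = 0` (on `[0, 1)`). [folklore] -/
theorem apr_eq_x_iff (m : Fin 3) {t : ℝ} (ht : t ∈ Ico (0 : ℝ) 1) : S.apr m t = S.x ↔ t = 0 := by
  constructor
  · intro h
    rw [← S.apr_zero m] at h
    exact S.injOn_apr m ht ⟨le_rfl, zero_lt_one⟩ h
  · rintro rfl; exact S.apr_zero m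

/-- `gate m ∖ {x} = A_m (0, 1)`. [folklore] -/
theorem gate_diff_eq (m : Fin 3) : S.gate m \ {S.x} = S.apr m '' Ioo 0 1 := by
  ext z
  constructor
  · rintro ⟨hz, hzx⟩
    obtain ⟨t, ht, rfl⟩ := S.exists_apr_eq m hz
    refine ⟨t, ⟨lt_of_le_of_ne ht.1 fun h ↦ hzx ?_, ht.2⟩, rfl⟩
    rw [mem_singleton_iff, S.apr_eq_x_iff m ht]; exact h.symm
  · rintro ⟨t, ht, rfl⟩
    refine ⟨S.apr_mem_gate m ⟨ht.1.le, ht.2⟩, fun h ↦ ?_⟩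
    rw [mem_singleton_iff, S.apr_eq_x_iff m ⟨ht.1.le, ht.2⟩] at h
    exact ht.1.ne' h

/-- `gate m ∖ {x}` is preconnected. [folklore] -/
theorem isPreconnected_gate_diff (m : Fin 3) : IsPreconnected (S.gate m \ {S.x}) := by
  rw [S.gate_diff_eq m]
  exact isPreconnected_Ioo.image _ (S.continuous_apr m).continuousOn

/-- The boundary endpoint of gate `m` is a closure point of `gate m ∖ {x}`. [folklore] -/
theorem aprEnd_mem_closure (m : Fin 3) : S.aprEnd m ∈ closure (S.gate m \ {S.x}) := by
  rw [S.gate_diff_eq m, ← S.apr_one m]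
  refine image_closure_subset_closure_image (S.continuous_apr m) ⟨1, ?_, rfl⟩
  rw [closure_Ioo zero_ne_one]; exact right_mem_Icc.2 zero_le_one

/-- **`ψ(gate m ∖ {x})` is not contained in any disc `closedBall 0 R`, `R < 1`.** [folklore] -/
theorem not_image_gate_subset_closedBall (m : Fin 3) {R : ℝ} (hR : R < 1) :
    ¬ S.ψ '' (S.gate m \ {S.x}) ⊆ closedBall 0 R :=
  S.not_subset_closedBall_of_mem_closure (Set.sdiff_subset.trans (S.gate_subset_Ω m))
    (S.aprEnd_mem_closure m) (S.aprEnd_notMem m) hR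

/-! ### Two-sidedness at `c` in the disc -/

/-- **Two-sidedness at `c` in the disc.** Let `j` be a Jordan loop through `c = ψ x` which,
over `B(x, ρ₀)`, consists only of `ψ`-images of points of the two gates other than `m`. Then
the `ψ`-images of the germs `P_m`, `P'_m` (`ρ ≤ ρ₀`) lie on different sides of `j`. (Local
two-sidedness at `c` with `V = ψ(B(x,ρ))` and the exceptional set `range j ∪ ψ(G ∩ B̄(x,ρ))`
of empty interior.) [cite: LawlerSchrammWerner2004, proof of Lemma 5.4] -/
theorem two_sided {j : ℝ → ℂ} (hj : IsJordanLoop j) (hc : S.c ∈ range j) (m : Fin 3)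
    (hloc : ∀ z ∈ ball S.x S.rho, z ∈ S.Ω → S.ψ z ∈ range j → ∃ i, i ≠ m ∧ z ∈ S.gate i)
    {ρ : ℝ} (hρ0 : 0 < ρ) (hρ : ρ ≤ S.rho) :
    (S.ψ '' S.regP m ρ ⊆ IsJordanLoop.inside j ∧ S.ψ '' S.regP' m ρ ⊆ IsJordanLoop.outside j) ∨
      (S.ψ '' S.regP m ρ ⊆ IsJordanLoop.outside j ∧ S.ψ '' S.regP' m ρ ⊆ IsJordanLoop.inside j) := by
  have hρr : ρ ≤ S.r := hρ.trans S.rho_le_r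
  have hρB : ρ ≤ 9 * S.r / 10 := hρ.trans S.rho_le_B₀
  have hballΩ : ball S.x ρ ⊆ S.Ω := S.ball_subset_Ω hρB
  have hcbΩ : closedBall S.x ρ ⊆ S.Ω := (closedBall_subset_closedBall hρB).trans S.closedBall_subset
  refine hj.subset_inside_or_of_nhds' hc (V := S.ψ '' ball S.x ρ)
    (E := range j ∪ S.ψ '' (S.G ∩ closedBall S.x ρ)) (S.image_ψ_ball_mem_nhds hρ0 hρB)
    ?_ ?_ ?_ ?_ ?_ ?_
  · rw [interior_union_isClosed_of_interior_empty hj.isCompact_range.isClosed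
      (S.interior_image_ψ inter_subset_left (inter_subset_right.trans hcbΩ)), hj.interior_range_eq]
  · rintro w ⟨⟨z, hz, rfl⟩, hwE⟩
    have hzG : z ∉ S.G := fun h ↦ hwE (Or.inr ⟨z, ⟨h, ball_subset_closedBall hz⟩, rfl⟩)
    rcases S.mem_regP_or_regP' m hρr hz hzG with h | h
    · exact Or.inl ⟨z, h, rfl⟩
    · exact Or.inr ⟨z, h, rfl⟩
  · exact (S.isPreconnected_regP m hρ0 hρr).image _
      (S.ψ_cont.mono ((S.regP_subset_ball m ρ).trans hballΩ))
  · exact (S.isPreconnected_regP' m hρ0 hρr).image _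
      (S.ψ_cont.mono ((S.regP'_subset_ball m ρ).trans hballΩ))
  · rintro w ⟨z, hz, rfl⟩ hw
    have hzb := S.regP_subset_ball m ρ hz
    obtain ⟨i, -, hzi⟩ := hloc z (ball_subset_ball hρ hzb) (hballΩ hzb) hw
    exact Set.disjoint_left.1 (S.regP_disjoint_G m ρ) hz (S.gate_subset_G i hzi)
  · rintro w ⟨z, hz, rfl⟩ hw
    have hzb := S.regP'_subset_ball m ρ hz
    obtain ⟨i, him, hzi⟩ := hloc z (ball_subset_ball hρ hzb) (hballΩ hzb) hw
    exact S.not_mem_gate_of_mem_regP' him hρ hz hzi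

/-- **If `P'_m` reaches the outside then `ψ(P_m) ⊆ inside j`.** [folklore] -/
theorem image_regP_subset_inside {j : ℝ → ℂ} (hj : IsJordanLoop j) (hc : S.c ∈ range j) (m : Fin 3)
    (hloc : ∀ z ∈ ball S.x S.rho, z ∈ S.Ω → S.ψ z ∈ range j → ∃ i, i ≠ m ∧ z ∈ S.gate i)
    {ρ : ℝ} (hρ0 : 0 < ρ) (hρ : ρ ≤ S.rho)
    (hout : (S.ψ '' S.regP' m ρ ∩ IsJordanLoop.outside j).Nonempty) :
    S.ψ '' S.regP m ρ ⊆ IsJordanLoop.inside j := by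
  rcases S.two_sided hj hc m hloc hρ0 hρ with ⟨h, -⟩ | ⟨-, h⟩
  · exact h
  · exfalso
    obtain ⟨w, hw, hwo⟩ := hout
    exact Set.disjoint_left.1 IsJordanLoop.disjoint_inside_outside (h hw) hwo

/-- **From the germ to the chamber**: if `ψ(P_m) ⊆ inside j`, then every preconnected `T ⊆ Ω`
meeting `V_m` whose `ψ`-image avoids `j` (as does `ψ(V_m)`) has `ψ(T) ⊆ inside j`. [folklore] -/
theorem image_subset_inside_of_germ {j : ℝ → ℂ} (hj : IsJordanLoop j) {m : Fin 3} {ρ : ℝ}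
    (hρ0 : 0 < ρ) (hP : S.ψ '' S.regP m ρ ⊆ IsJordanLoop.inside j)
    (hV : ∀ z ∈ S.V m, S.ψ z ∉ range j) {T : Set ℂ} (hT : IsPreconnected T) (hTΩ : T ⊆ S.Ω)
    (hTj : ∀ z ∈ T, S.ψ z ∉ range j) (hTV : (T ∩ S.V m).Nonempty) :
    S.ψ '' T ⊆ IsJordanLoop.inside j := by
  have hVi : S.ψ '' S.V m ⊆ IsJordanLoop.inside j := by
    refine hj.subset_inside_of_inter_nonempty ((S.isPreconnected_V m).image _
      (S.ψ_cont.mono ((S.V_subset_B₀ m).trans S.B₀_subset))) ?_ ?_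
    · rintro w ⟨z, hz, rfl⟩; exact hV z hz
    · obtain ⟨z, hzV, hzP⟩ := S.V_inter_regP_nonempty m hρ0
      exact ⟨S.ψ z, ⟨z, hzV, rfl⟩, hP ⟨z, hzP, rfl⟩⟩
  refine hj.subset_inside_of_inter_nonempty (hT.image _ (S.ψ_cont.mono hTΩ)) ?_ ?_
  · rintro w ⟨z, hz, rfl⟩; exact hTj z hz
  · obtain ⟨z, hzT, hzV⟩ := hTV
    exact ⟨S.ψ z, ⟨z, hzT, rfl⟩, hVi ⟨z, hzV, rfl⟩⟩

/-- **From the complementary germ to the two other chambers**: if `ψ(P'_m) ⊆ inside j` and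
`l ≠ m`, then every preconnected `T ⊆ Ω` meeting `V_l` whose `ψ`-image avoids `j` (as does
`ψ(V_l)`) has `ψ(T) ⊆ inside j`. [folklore] -/
theorem image_subset_inside_of_germ' {j : ℝ → ℂ} (hj : IsJordanLoop j) {l m : Fin 3} (hlm : l ≠ m)
    {ρ : ℝ} (hρ0 : 0 < ρ) (hP' : S.ψ '' S.regP' m ρ ⊆ IsJordanLoop.inside j)
    (hV : ∀ z ∈ S.V l, S.ψ z ∉ range j) {T : Set ℂ} (hT : IsPreconnected T) (hTΩ : T ⊆ S.Ω)
    (hTj : ∀ z ∈ T, S.ψ z ∉ range j) (hTV : (T ∩ S.V l).Nonempty) :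
    S.ψ '' T ⊆ IsJordanLoop.inside j := by
  have hVi : S.ψ '' S.V l ⊆ IsJordanLoop.inside j := by
    refine hj.subset_inside_of_inter_nonempty ((S.isPreconnected_V l).image _
      (S.ψ_cont.mono ((S.V_subset_B₀ l).trans S.B₀_subset))) ?_ ?_
    · rintro w ⟨z, hz, rfl⟩; exact hV z hz
    · obtain ⟨z, hzV, hzP⟩ := S.V_inter_regP'_nonempty hlm hρ0
      exact ⟨S.ψ z, ⟨z, hzV, rfl⟩, hP' ⟨z, hzP, rfl⟩⟩
  refine hj.subset_inside_of_inter_nonempty (hT.image _ (S.ψ_cont.mono hTΩ)) ?_ ?_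
  · rintro w ⟨z, hz, rfl⟩; exact hTj z hz
  · obtain ⟨z, hzT, hzV⟩ := hTV
    exact ⟨S.ψ z, ⟨z, hzT, rfl⟩, hVi ⟨z, hzV, rfl⟩⟩

end Setup

end ThreeChamber

end Literature.Analysis.Complex
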